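import Summits.BirchSwinnertonDyer.BirchSwinnertonDyer.Theses.TwistFamilyManinDescent
import Summits.BirchSwinnertonDyer.Rank1Residual.LW16.IsogenyKummerDegenerationReducible
import Literature.NumberTheory.EllipticCurves.OpenImage
import HarnessLib

/-!
# Route `TwistFamilyManinDescent` — support item `LargePrimeReducibleJ` (stmt-BirchSwinnertonDyer-25139) GRANTED its
# two printed inputs (Mazur 1978 Thm 1; the rational points of `X₀(ℓ)`, `ℓ ∈ {11,17,19,37,43,67,163}`)

HONEST FRAMING / DATUM FOR THE PLANNER. The item is typed UNCONDITIONALLY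
(`∀ W p, 11 ≤ p → p ≠ 13 → ¬ Irr W p → (p, j(W)) ∈ largePrimeIsogenyJTable`), but its two printed inputs are
cite-only NAMED FACTS of the tree, not theorems: Mazur's isogeny theorem `mazur_isogeny_irreducible` (`OpenImage.lean`)
and the `X₀(ℓ)(ℚ)` table `primeDegreeIsogeny_jTable` (`PrimeDegreeIsogenyJTable.lean`). So the item cannot be
closed by name as filed; what is provable now — and proved here — is the CONDITIONAL form
`mazur_isogeny_irreducible → primeDegreeIsogeny_jTable → LargePrimeReducibleJ`, the third input «reducible ⇒ a
rational `p`-isogeny» being a tree THEOREM (`exists_isogeny_comp_eq_prime_smul_of_not_irreducible`, over the proved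
quotient-isogeny construction). Suggested restatement of 25139: prefix the two facts as leading binders (the shape
of the route's other items), or move it into the cite bundle. Nothing about Manin's conjecture or BSD is proved here.
-/

-- D-0017: single-problem summit, so `Summit.BirchSwinnertonDyer.BirchSwinnertonDyer.…` repeats a namespace BY DESIGN.
set_option linter.dupNamespace false
set_option autoImplicit false

open WeierstrassCurve Literature.NumberTheory.EllipticCurves Literature.NumberTheory.EllipticCurves.Rank1Residual
  Summit.BirchSwinnertonDyer.BirchSwinnertonDyer.Theses.TwistFamilyManinDescent

namespace Summit.BirchSwinnertonDyer.BirchSwinnertonDyer.Theorems.TwistFamilyManinDescent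

/-- **`LargePrimeReducibleJ` (stmt-25139) from Mazur's isogeny theorem and the `X₀(ℓ)(ℚ)` table.** For `W/ℚ`
elliptic and a prime `p ≥ 11`, `p ≠ 13`, with `E[p]` reducible: Mazur (`mazur_isogeny_irreducible`, hypothesis)
puts `p` in `{11, 17, 19, 37, 43, 67, 163}`; reducibility gives a `ℚ`-rational isogeny of degree `p`
(`exists_isogeny_comp_eq_prime_smul_of_not_irreducible`, a tree theorem); the table fact
(`primeDegreeIsogeny_jTable`, hypothesis) puts `(p, j(W))` in `largePrimeIsogenyJTable`.
[cite: Mazur1978, Thm. 1] [cite: Kenku1982, Thm. 1] [cite: CremonaAlgorithms1997, §3.8 p. 82] -/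
theorem largePrimeReducibleJ_of_facts (hM : mazur_isogeny_irreducible) (hT : primeDegreeIsogeny_jTable) :
    LargePrimeReducibleJ := by
  unfold LargePrimeReducibleJ
  intro W _ p _ hp11 hp13 hred
  have hp : p.Prime := Fact.out
  -- Mazur: `p` is one of the isogeny primes
  have hmem : p ∈ mazurPrimes := by
    by_contra h
    exact hred (hM W p hp h)
  have hp' : p ∈ ({11, 17, 19, 37, 43, 67, 163} : Finset ℕ) := by
    simp only [mazurPrimes, Finset.mem_insert, Finset.mem_singleton] at hmem
    simp only [Finset.mem_insert, Finset.mem_singleton]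
    omega
  -- a rational `p`-isogeny out of `W`
  obtain ⟨W', hW', φ, -, hdeg, -, -⟩ :=
    Summit.BirchSwinnertonDyer.Rank1Residual.LW16.IsogenyEdge.exists_isogeny_comp_eq_prime_smul_of_not_irreducible W hred
  haveI := hW'
  have h := hT W W' φ (by rw [hdeg]; exact hp')
  rwa [hdeg] at h

end Summit.BirchSwinnertonDyer.BirchSwinnertonDyer.Theorems.TwistFamilyManinDescent
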